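import Mathlib
import Literature.NumberTheory.Transcendental.KontsevichZagierGammaProofs
import Literature.Barriers.Schanuel.NesterenkoModularScopeConjectureProofs
import Summits.KontsevichZagierPeriods.KontsevichZagierPeriods.Theorems.GrothendieckKEAlgIndependent

/-!
# `TateLifting` (stmt-KontsevichZagierPeriods-9129), line `Sketch` — stub 36 `tateLifting_betaQuarterPiAlgIndependent`

LEMNISCATIC INPUT of the transcendental sector of the crux `TateLifting` (kernel form of the
Kontsevich–Zagier period conjecture, route `InverseLandau`): the Beta value
`B := B(1/4, 1/4) = ∫₀¹ t^{-3/4} (1 − t)^{-3/4} dt = Γ(1/4)² / Γ(1/2) = Γ(1/4)² / √π`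
(`ProbabilityTheory.beta ↑(1/4) ↑(1/4)`) and `π` are algebraically independent over `ℚ`.

## Proof

Put `F := ℚ(B, π) ⊆ ℝ`.

* By definition `ProbabilityTheory.beta α β = Γ(α) Γ(β) / Γ(α + β)`, so `B = Γ(1/4)² / Γ(1/2)`,
  and `Γ(1/2) = √π` (`Real.Gamma_one_half_eq`); hence `Γ(1/4)⁴ = π B² ∈ F`, so `Γ(1/4)` is
  algebraic over `F` (`IsAlgebraic.of_pow`).
* Hence `trdeg_ℚ F(π, Γ(1/4)) = trdeg_ℚ F`
  (`Literature.Barriers.Schanuel.trdeg_adjoin_union_eq_of_isAlgebraic_adjoin`).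
* Chudnovsky (1976): `π`, `Γ(1/4)` are algebraically independent over `ℚ`
  (`Literature.NumberTheory.Transcendental.algebraicIndependent_real_pi_gamma_one_quarter`), so
  `2 ≤ trdeg_ℚ F(π, Γ(1/4))`
  (`Summit.KontsevichZagierPeriods.Grothendieck.le_trdeg_adjoin_of_algebraicIndependent`).
* `2 ≤ trdeg_ℚ ℚ(B, π)` forces `![B, π]` algebraically independent
  (`Literature.Barriers.Schanuel.algebraicIndependent_of_le_trdeg_adjoin`).

References: G. V. Chudnovsky, *Contributions to the theory of transcendental numbers* (1984),
Ch. 7 §2 Cor. 2.3; M. Waldschmidt, *Elliptic functions and transcendence* (2008), §5.2 Cor. 33.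
-/

noncomputable section

open IntermediateField

namespace Summit.KontsevichZagierPeriods.InverseLandau

open Literature.NumberTheory.Transcendental
open Summit.KontsevichZagierPeriods.Grothendieck (le_trdeg_adjoin_of_algebraicIndependent)

/-- **The Beta value `B(1/4, 1/4)`:** `B(1/4, 1/4) = Γ(1/4)² / √π`
(`ProbabilityTheory.beta α β = Γ(α) Γ(β) / Γ(α + β)` by definition, and `Γ(1/2) = √π`,
`Real.Gamma_one_half_eq`). [folklore] -/
theorem beta_one_quarter_one_quarter_eq :
    ProbabilityTheory.beta ((1 / 4 : ℚ) : ℝ) ((1 / 4 : ℚ) : ℝ) =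
      Real.Gamma (1 / 4) ^ 2 / Real.sqrt Real.pi := by
  have hcast : ((1 / 4 : ℚ) : ℝ) = 1 / 4 := by norm_num
  rw [hcast, ProbabilityTheory.beta, show (1 : ℝ) / 4 + 1 / 4 = 1 / 2 by norm_num,
    Real.Gamma_one_half_eq, sq]

/-- **`Γ(1/4)⁴ = π B(1/4,1/4)²`** (from `B = Γ(1/4)²/√π` and `(√π)² = π`). [folklore] -/
theorem gamma_one_quarter_pow_four_eq :
    Real.Gamma (1 / 4) ^ 4 =
      Real.pi * ProbabilityTheory.beta ((1 / 4 : ℚ) : ℝ) ((1 / 4 : ℚ) : ℝ) ^ 2 := by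
  have hsqrt : Real.sqrt Real.pi ^ 2 = Real.pi := Real.sq_sqrt Real.pi_pos.le
  have hpi : Real.pi ≠ 0 := Real.pi_ne_zero
  rw [beta_one_quarter_one_quarter_eq, div_pow, hsqrt, ← pow_mul,
    show 2 * 2 = 4 by norm_num, mul_div_cancel₀ _ hpi]

/-- **`B(1/4, 1/4)` and `π` are algebraically independent over `ℚ`** (stub 36
`tateLifting_betaQuarterPiAlgIndependent` of the line `Sketch` of the crux `TateLifting`,
stmt-KontsevichZagierPeriods-9129). With `F = ℚ(B, π)`, `B = Γ(1/4)²/Γ(1/2) = Γ(1/4)²/√π` puts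
`Γ(1/4)⁴ = π B² ∈ F`, so `Γ(1/4)` is algebraic over `F` and
`trdeg_ℚ F = trdeg_ℚ F(π, Γ(1/4)) ≥ 2` by Chudnovsky's theorem (`π`, `Γ(1/4)` algebraically
independent, tree theorem `algebraicIndependent_real_pi_gamma_one_quarter`); a pair generating a
field of transcendence degree `≥ 2` is algebraically independent.
[cite: Chudnovsky1984, Ch. 7 §2 Corollary 2.3] -/
theorem tateLifting_betaQuarterPiAlgIndependent :
    AlgebraicIndependent ℚ ![ProbabilityTheory.beta ((1 / 4 : ℚ) : ℝ) ((1 / 4 : ℚ) : ℝ), Real.pi] := by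
  set B : ℝ := ProbabilityTheory.beta ((1 / 4 : ℚ) : ℝ) ((1 / 4 : ℚ) : ℝ) with hB_def
  have hG4 : Real.Gamma (1 / 4) ^ 4 = Real.pi * B ^ 2 := gamma_one_quarter_pow_four_eq
  set l : Fin 2 → ℝ := ![B, Real.pi]
  set S : Set ℝ := Set.range l
  set F : IntermediateField ℚ ℝ := adjoin ℚ S
  have hBF : B ∈ F := subset_adjoin ℚ S ⟨0, rfl⟩
  have hpiF : Real.pi ∈ F := subset_adjoin ℚ S ⟨1, rfl⟩
  -- `Γ(1/4)⁴ = π B² ∈ F`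
  have hG4F : Real.Gamma (1 / 4) ^ 4 ∈ F := by
    rw [hG4]
    exact mul_mem hpiF (pow_mem hBF 2)
  -- `T = {π, Γ(1/4)}` is algebraic over `F`
  set T : Set ℝ := {Real.pi, Real.Gamma (1 / 4)}
  have hTalg : ∀ x ∈ T, IsAlgebraic F x := by
    intro x hx
    rcases hx with rfl | rfl
    · exact isAlgebraic_algebraMap (⟨Real.pi, hpiF⟩ : F)
    · have h4 : IsAlgebraic F (Real.Gamma (1 / 4) ^ 4) :=
        isAlgebraic_algebraMap (⟨Real.Gamma (1 / 4) ^ 4, hG4F⟩ : F)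
      exact h4.of_pow (by norm_num)
  -- Chudnovsky: `2 ≤ trdeg_ℚ ℚ(S ∪ T)`
  have hy : AlgebraicIndependent ℚ ![Real.pi, Real.Gamma (1 / 4)] :=
    algebraicIndependent_real_pi_gamma_one_quarter
  have hyST : ∀ i, (![Real.pi, Real.Gamma (1 / 4)] : Fin 2 → ℝ) i ∈ adjoin ℚ (S ∪ T) := by
    intro i
    refine subset_adjoin ℚ (S ∪ T) (Or.inr ?_)
    fin_cases i
    · exact Or.inl rfl
    · exact Or.inr rfl
  have h2 := le_trdeg_adjoin_of_algebraicIndependent (S ∪ T) _ hy hyST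
  -- transfer to `F = ℚ(S)` and conclude
  rw [Literature.Barriers.Schanuel.trdeg_adjoin_union_eq_of_isAlgebraic_adjoin S T hTalg] at h2
  exact Literature.Barriers.Schanuel.algebraicIndependent_of_le_trdeg_adjoin l h2

end Summit.KontsevichZagierPeriods.InverseLandau

end
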